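import Mathlib
import HarnessLib
import Summits.HubbardSuperconductivity.HubbardSuperconductivity.Theorems.KLProgrammeKLRegimeSplitPredicates

/-!
# Route `KLProgramme` — engine support: the first and second derivative bounds of an admissible frame band, `‖De_K‖ ≤ 7`, `‖D²e_K‖ ≤ 7`,
# in the shape consumed by the `ℓ²`-route files (`K₁`, `K₂` of `KLProgrammeKLRegimeSectorSlicePair.slicePair_charSum_l1_le`)

Cell `gate-hubbard-kl`, seat hubbard-kl-k3c2-p3; gen-4 ENGINE child stmt-HubbardSuperconductivity-19855 (`stub_engine_step_norms`).  `FrameOK R U N μ K`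
(i) is `GeomConstants (frameLevel μ K) 7 (3/80) (1/2) (3/200)`, whose first field bounds all derivatives of order `≤ 2` by `7`; here the two
instances `j = 1` (through `norm_iteratedFDeriv_one`) and `j = 2` are spelled out.  Everything is proved; no definitions, no named facts. [folklore]
-/

noncomputable section

namespace Summit.HubbardSuperconductivity.HubbardSuperconductivity.Theorems.TorusFourierL2

set_option linter.dupNamespace false -- summit = problem name (single-conjunct summit), D-0017

open Literature.MathematicalPhysics.QuantumLattice Literature.Probability.LatticeModels
open Summit.HubbardSuperconductivity.HubbardSuperconductivity.Theorems.DispersionFlow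
open Summit.HubbardSuperconductivity.HubbardSuperconductivity.Theorems.KLRegimeSplit

/-- **`‖De_K(p)‖ ≤ 7`** for an admissible frame. [folklore] -/
theorem norm_fderiv_frameLevel_le_of_frameOK {R : RenConsts} {U : ℝ} {N : ℕ} {μ : ℝ} {K : TrigPolyC4v} (hK : FrameOK R U N μ K)
    (p : EuclideanSpace ℝ (Fin 2)) : ‖fderiv ℝ (frameLevel μ K) p‖ ≤ 7 := by
  rw [← norm_iteratedFDeriv_one]
  exact hK.1.norm_iteratedFDeriv_le p 1 (by norm_num)

/-- **`‖D²e_K(p)‖ ≤ 7`** for an admissible frame. [folklore] -/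
theorem norm_iteratedFDeriv_two_frameLevel_le_of_frameOK {R : RenConsts} {U : ℝ} {N : ℕ} {μ : ℝ} {K : TrigPolyC4v}
    (hK : FrameOK R U N μ K) (p : EuclideanSpace ℝ (Fin 2)) : ‖iteratedFDeriv ℝ 2 (frameLevel μ K) p‖ ≤ 7 :=
  hK.1.norm_iteratedFDeriv_le p 2 le_rfl

/-- **`|e_K(p)| ≤ 7`** for an admissible frame (order `0`). [folklore] -/
theorem abs_frameLevel_le_of_frameOK {R : RenConsts} {U : ℝ} {N : ℕ} {μ : ℝ} {K : TrigPolyC4v} (hK : FrameOK R U N μ K)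
    (p : EuclideanSpace ℝ (Fin 2)) : |frameLevel μ K p| ≤ 7 := by
  have h := hK.1.norm_iteratedFDeriv_le p 0 (by norm_num)
  rwa [norm_iteratedFDeriv_zero, Real.norm_eq_abs] at h

end Summit.HubbardSuperconductivity.HubbardSuperconductivity.Theorems.TorusFourierL2

end
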